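import Literature.Analysis.FunctionSpaces.PolchinskiFamilyDerivative
import Literature.Analysis.FunctionSpaces.PolchinskiDualGenerator
import HarnessLib

/-!
# The dual identity with a time-dependent test function: `−d/dt E_{ν_t}[G_t] = E_{ν_t}[L_tG_t − ∂_tG_t]`
# (Bauerschmidt–Bodineau–Dagallier, proof of Theorem 3, first step of (e:dEnt))

Topic `Literature/Analysis/FunctionSpaces`; tenth "proof architecture" file behind the named fact
`Polchinski.BauerschmidtBodineau_multiscaleBakryEmery` ([BBD] Theorem 3, `MultiscaleBakryEmery.lean`).
[BBD] p0016 L47–55: «using first (e:polchinski-semigroup) and then (e:polchinski-L),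
`−d/dt E_{ν_t}[Φ(F_t)] = E_{ν_t}[L_t(Φ(F_t)) − Φ′(F_t)Ḟ_t]`» — the dual identity of Proposition 8 applied
to a test function that itself depends on `t`.  This file proves that rule for an ABSTRACT family
`G : ℝ → ℝ^N → ℝ`: if `G_t ∈ C_b²`, the `G_s` are continuous and uniformly bounded, and `s ↦ G_s(y)` is
differentiable at `t` uniformly in `y` with bounded uniformly continuous derivative `Ġ`, then
`d/dt E_{ν_t}[G_t] = −E_{ν_t}[L_tG_t − Ġ]` (`PolchinskiDualGenerator.lean` is the case `Ġ = 0`).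
Proof: `E_{ν_s}[G_s] = e^{V_∞(0)}E_{C_∞−C_s}[Z_sG_s]`; the family `K_s = Z_sG_s` satisfies the hypotheses of
`hasDerivAt_integral_family_Cinf_sub` (uniform slope `K̇ = Ż_tG_t + Z_tĠ` from those of `Z` and `G`),
and the algebra `−½ΣĊ D²(Z G)_{ij} + ŻG = −Z L_tG` of `PolchinskiDualGenerator.lean`.

## Main results (sorry-free; no new definitions, no new named facts)

* `hasDerivAt_integral_renormDensity_mul_family` — the joint derivative of
  `s ↦ E_{C_∞−C_s}[Z_s G_s(φ+·)]`.
* **`hasDerivAt_renormExpect_family`** — `d/dt E_{ν_t}[G_t] = −E_{ν_t}[L_tG_t − Ġ]` for `t > 0`.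

Hypotheses on `V₀` as in `PolchinskiDualGenerator.lean` (`e^{−V₀}` twice differentiable, `∇e^{−V₀}` bounded,
`D²e^{−V₀}` bounded uniformly continuous, `V₀` bounded below); possibly degenerate `Ċ_t`.
-- TODO(general form): the instance `G_t = Φ(P_{0,t}F)` needs the uniform slope of `Φ(W_t/Z_t)`, available
-- when `∇V₀` is bounded (then `Z_s/Z_t` is uniformly controlled); see the seat's LIT-INDEX roadmap (P7/P9).
Nothing here concerns Yang–Mills.

## References

* [BauerschmidtBodineauDagallier2023] R. Bauerschmidt, T. Bodineau, B. Dagallier, Probab. Surveys 21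
  (2024) 200–290, arXiv:2307.07619 — Prop 8 p0014–p0015, Thm 3 proof p0016 L47–88. READ (held).
-/

noncomputable section

-- nested operator-norm instances `E →L[ℝ] E →L[ℝ] ℝ`
set_option maxSynthPendingDepth 2

open MeasureTheory ProbabilityTheory Filter Topology Set Asymptotics
open scoped RealInnerProductSpace Matrix MatrixOrder

namespace Literature.Analysis.FunctionSpaces

namespace Polchinski

variable {N : ℕ}

section Helpers

/-- Uniform continuity from a bounded Fréchet derivative. [folklore] -/
private theorem uc_of_fderiv_bound {Y : Type*} [NormedAddCommGroup Y] [NormedSpace ℝ Y]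
    {H : EuclideanSpace ℝ (Fin N) → Y} {DH : EuclideanSpace ℝ (Fin N) → EuclideanSpace ℝ (Fin N) →L[ℝ] Y}
    (h1 : ∀ x, HasFDerivAt H (DH x) x) {K : ℝ} (hK : ∀ x, ‖DH x‖ ≤ K) : UniformContinuous H := by
  have hK0 : 0 ≤ K := le_trans (norm_nonneg _) (hK 0)
  have hlip : ∀ a b : EuclideanSpace ℝ (Fin N), ‖H a - H b‖ ≤ K * ‖a - b‖ := fun a b =>
    Convex.norm_image_sub_le_of_norm_hasFDerivWithin_le (𝕜 := ℝ) (s := univ)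
      (fun x _ => (h1 x).hasFDerivWithinAt) (fun x _ => hK x) convex_univ (mem_univ b) (mem_univ a)
  rw [Metric.uniformContinuous_iff]
  intro ε hε
  refine ⟨ε / (K + 1), by positivity, fun {a b} hab => ?_⟩
  rw [dist_eq_norm] at hab ⊢
  calc ‖H a - H b‖ ≤ K * ‖a - b‖ := hlip a b
    _ ≤ K * (ε / (K + 1)) := mul_le_mul_of_nonneg_left hab.le hK0
    _ < ε := by
      rw [mul_div_assoc']
      rw [div_lt_iff₀ (by positivity)]
      nlinarith

/-- The product of a bounded uniformly continuous scalar function and a bounded uniformly continuous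
vector-valued function is uniformly continuous. [folklore] -/
private theorem uc_smul {Y : Type*} [NormedAddCommGroup Y] [NormedSpace ℝ Y]
    {a : EuclideanSpace ℝ (Fin N) → ℝ} {b : EuclideanSpace ℝ (Fin N) → Y}
    (ha : UniformContinuous a) (hb : UniformContinuous b) {A : ℝ} (hA : ∀ x, |a x| ≤ A)
    {B : ℝ} (hB : ∀ x, ‖b x‖ ≤ B) : UniformContinuous fun x => a x • b x := by
  have hA0 : 0 ≤ A := le_trans (abs_nonneg _) (hA 0)
  have hB0 : 0 ≤ B := le_trans (norm_nonneg _) (hB 0)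
  rw [Metric.uniformContinuous_iff]
  intro ε hε
  obtain ⟨δa, hδa, ha'⟩ := Metric.uniformContinuous_iff.mp ha (ε / (2 * (B + 1))) (by positivity)
  obtain ⟨δb, hδb, hb'⟩ := Metric.uniformContinuous_iff.mp hb (ε / (2 * (A + 1))) (by positivity)
  refine ⟨min δa δb, lt_min hδa hδb, fun {x y} hxy => ?_⟩
  have hxa : dist x y < δa := lt_of_lt_of_le hxy (min_le_left _ _)
  have hxb : dist x y < δb := lt_of_lt_of_le hxy (min_le_right _ _)
  have h1 := ha' hxa
  have h2 := hb' hxb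
  rw [dist_eq_norm] at h1 h2 ⊢
  have hsplit : a x • b x - a y • b y = a x • (b x - b y) + (a x - a y) • b y := by
    rw [smul_sub, sub_smul]; abel
  rw [hsplit]
  calc ‖a x • (b x - b y) + (a x - a y) • b y‖
      ≤ ‖a x • (b x - b y)‖ + ‖(a x - a y) • b y‖ := norm_add_le _ _
    _ = |a x| * ‖b x - b y‖ + |a x - a y| * ‖b y‖ := by
        rw [norm_smul, norm_smul, Real.norm_eq_abs, Real.norm_eq_abs]
    _ ≤ A * (ε / (2 * (A + 1))) + (ε / (2 * (B + 1))) * B := by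
        have h1' : |a x - a y| ≤ ε / (2 * (B + 1)) := by rw [← Real.norm_eq_abs]; exact h1.le
        exact add_le_add (mul_le_mul (hA x) h2.le (norm_nonneg _) hA0)
          (mul_le_mul h1' (hB y) (norm_nonneg _) (by positivity))
    _ < ε := by
        have h3 : A * (ε / (2 * (A + 1))) < ε / 2 := by
          rw [mul_div_assoc', div_lt_div_iff₀ (by positivity) (by positivity)]; nlinarith
        have h4 : (ε / (2 * (B + 1))) * B < ε / 2 := by
          rw [div_mul_eq_mul_div, div_lt_div_iff₀ (by positivity) (by positivity)]; nlinarith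
        linarith

/-- `x ↦ c(x) ⊗ d(x)` (`smulRight`) is uniformly continuous for bounded uniformly continuous covector
fields `c`, `d`. [folklore] -/
private theorem uc_smulRight
    {c d : EuclideanSpace ℝ (Fin N) → EuclideanSpace ℝ (Fin N) →L[ℝ] ℝ}
    (hc : UniformContinuous c) (hd : UniformContinuous d) {Cc : ℝ} (hCc : ∀ x, ‖c x‖ ≤ Cc)
    {Cd : ℝ} (hCd : ∀ x, ‖d x‖ ≤ Cd) :
    UniformContinuous fun x => (c x).smulRight (d x) := by
  have hC0 : 0 ≤ Cc := le_trans (norm_nonneg _) (hCc 0)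
  have hD0 : 0 ≤ Cd := le_trans (norm_nonneg _) (hCd 0)
  rw [Metric.uniformContinuous_iff]
  intro ε hε
  obtain ⟨δc, hδc, hc'⟩ := Metric.uniformContinuous_iff.mp hc (ε / (2 * (Cd + 1))) (by positivity)
  obtain ⟨δd, hδd, hd'⟩ := Metric.uniformContinuous_iff.mp hd (ε / (2 * (Cc + 1))) (by positivity)
  refine ⟨min δc δd, lt_min hδc hδd, fun {x y} hxy => ?_⟩
  have h1 := hc' (lt_of_lt_of_le hxy (min_le_left _ _))
  have h2 := hd' (lt_of_lt_of_le hxy (min_le_right _ _))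
  rw [dist_eq_norm] at h1 h2 ⊢
  have hsplit : (c x).smulRight (d x) - (c y).smulRight (d y) =
      (c x - c y).smulRight (d x) + (c y).smulRight (d x - d y) := by
    refine ContinuousLinearMap.ext fun v => ContinuousLinearMap.ext fun w => ?_
    simp only [_root_.sub_apply, _root_.add_apply, ContinuousLinearMap.smulRight_apply,
      _root_.smul_apply, smul_eq_mul]
    ring
  rw [hsplit]
  calc ‖(c x - c y).smulRight (d x) + (c y).smulRight (d x - d y)‖
      ≤ ‖(c x - c y).smulRight (d x)‖ + ‖(c y).smulRight (d x - d y)‖ := norm_add_le _ _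
    _ = ‖c x - c y‖ * ‖d x‖ + ‖c y‖ * ‖d x - d y‖ := by
        rw [ContinuousLinearMap.norm_smulRight_apply, ContinuousLinearMap.norm_smulRight_apply]
    _ ≤ (ε / (2 * (Cd + 1))) * Cd + Cc * (ε / (2 * (Cc + 1))) :=
        add_le_add (mul_le_mul h1.le (hCd x) (norm_nonneg _) (by positivity))
          (mul_le_mul (hCc y) h2.le (norm_nonneg _) hC0)
    _ < ε := by
        have h3 : (ε / (2 * (Cd + 1))) * Cd < ε / 2 := by
          rw [div_mul_eq_mul_div, div_lt_div_iff₀ (by positivity) (by positivity)]; nlinarith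
        have h4 : Cc * (ε / (2 * (Cc + 1))) < ε / 2 := by
          rw [mul_div_assoc', div_lt_div_iff₀ (by positivity) (by positivity)]; nlinarith
        linarith

/-- Matrix elements of a bounded uniformly continuous Hessian: measurable, bounded, uniformly
continuous (scalar functions). [folklore] -/
private theorem eval₂_facts {D2 : EuclideanSpace ℝ (Fin N) →
      EuclideanSpace ℝ (Fin N) →L[ℝ] EuclideanSpace ℝ (Fin N) →L[ℝ] ℝ}
    {M : ℝ} (hM : ∀ x, ‖D2 x‖ ≤ M) (hUC : UniformContinuous D2) (i j : Fin N) :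
    Continuous (fun x => D2 x (EuclideanSpace.single i 1) (EuclideanSpace.single j 1)) ∧
    (∀ x, |D2 x (EuclideanSpace.single i 1) (EuclideanSpace.single j 1)| ≤ M) ∧
    UniformContinuous (fun x => D2 x (EuclideanSpace.single i 1) (EuclideanSpace.single j 1)) := by
  have hev : UniformContinuous fun L : EuclideanSpace ℝ (Fin N) →L[ℝ] EuclideanSpace ℝ (Fin N) →L[ℝ] ℝ =>
      L (EuclideanSpace.single i 1) (EuclideanSpace.single j 1) :=
    (ContinuousLinearMap.apply ℝ ℝ (EuclideanSpace.single j (1:ℝ))).uniformContinuous.comp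
      (ContinuousLinearMap.apply ℝ (EuclideanSpace ℝ (Fin N) →L[ℝ] ℝ)
        (EuclideanSpace.single i (1:ℝ))).uniformContinuous
  refine ⟨(hev.comp hUC).continuous, fun x => ?_, hev.comp hUC⟩
  rw [← Real.norm_eq_abs]
  calc ‖D2 x (EuclideanSpace.single i 1) (EuclideanSpace.single j 1)‖
      ≤ ‖D2 x (EuclideanSpace.single i 1)‖ * ‖EuclideanSpace.single j (1:ℝ)‖ :=
        ContinuousLinearMap.le_opNorm _ _
    _ ≤ ‖D2 x‖ * ‖EuclideanSpace.single i (1:ℝ)‖ * ‖EuclideanSpace.single j (1:ℝ)‖ :=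
        mul_le_mul_of_nonneg_right (ContinuousLinearMap.le_opNorm _ _) (norm_nonneg _)
    _ = ‖D2 x‖ := by simp
    _ ≤ M := hM x

/-- `|∫ f| ≤ C` on a probability space when `|f| ≤ C` pointwise. [folklore] -/
private theorem abs_integral_le_of_abs_le {f : EuclideanSpace ℝ (Fin N) → ℝ} {C : ℝ}
    (P : Measure (EuclideanSpace ℝ (Fin N))) [IsProbabilityMeasure P] (hf : ∀ x, |f x| ≤ C) :
    |∫ x, f x ∂P| ≤ C := by
  have h := norm_integral_le_of_norm_le_const (μ := P) (f := f) (C := C)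
    (Eventually.of_forall fun x => by rw [Real.norm_eq_abs]; exact hf x)
  rwa [Real.norm_eq_abs, probReal_univ, mul_one] at h

/-- Finite sums of uniformly continuous real functions are uniformly continuous. [folklore] -/
private theorem uc_finset_sum {ι : Type*} [DecidableEq ι] (S : Finset ι)
    (f : ι → EuclideanSpace ℝ (Fin N) → ℝ) (h : ∀ i ∈ S, UniformContinuous (f i)) :
    UniformContinuous fun x => ∑ i ∈ S, f i x := by
  induction S using Finset.induction_on with
  | empty => simpa using uniformContinuous_const
  | @insert a S ha ih =>
    have hfun : (fun x => ∑ i ∈ insert a S, f i x) = fun x => f a x + ∑ i ∈ S, f i x :=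
      funext fun x => Finset.sum_insert ha
    rw [hfun]
    exact (h a (Finset.mem_insert_self a S)).add
      (ih fun i hi => h i (Finset.mem_insert_of_mem hi))

end Helpers

section DualFamily

variable (D : CovDecomposition N) {V₀ : EuclideanSpace ℝ (Fin N) → ℝ}
  {D1 : EuclideanSpace ℝ (Fin N) → EuclideanSpace ℝ (Fin N) →L[ℝ] ℝ}
  {D2 : EuclideanSpace ℝ (Fin N) → EuclideanSpace ℝ (Fin N) →L[ℝ] EuclideanSpace ℝ (Fin N) →L[ℝ] ℝ}
  {G : ℝ → EuclideanSpace ℝ (Fin N) → ℝ}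
  {DG : EuclideanSpace ℝ (Fin N) → EuclideanSpace ℝ (Fin N) →L[ℝ] ℝ}
  {D2G : EuclideanSpace ℝ (Fin N) → EuclideanSpace ℝ (Fin N) →L[ℝ] EuclideanSpace ℝ (Fin N) →L[ℝ] ℝ}
  {Gd : EuclideanSpace ℝ (Fin N) → ℝ}
set_option maxHeartbeats 400000 in -- buildfix (bf3-g30): 160k/180k FAIL, 200k PASS at accept time; line-neutral budget line
/-- **Joint derivative of `s ↦ E_{C_∞−C_s}[Z_s G_s(φ+·)]` for a time-dependent family `G_s`**:
`d/ds|_{s=t} = −½ΣĊ_t^{ij}E_{C_∞−C_t}[∂_i∂_j(Z_tG_t)(φ+·)] + E_{C_∞−C_t}[(Ż_tG_t + Z_tĠ)(φ+·)]`, where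
`Z_s = e^{−V_s} = E_{C_s}[e^{−V₀}(·+w)]`, `Ż_t = ½Δ_{Ċ_t}Z_t`, and `Ġ` is the uniform-in-space `s`-derivative of
`G_s` at `t` ([BBD] proof of Thm 3: «both `ν_t` and `F_t` vary with `t`»; the case `Ġ = 0` is
`hasDerivAt_integral_renormDensity_mul`). [cite: BauerschmidtBodineauDagallier2023, Theorem 3 (proof, (e:dEnt))] -/
theorem hasDerivAt_integral_renormDensity_mul_family
    (hG1 : ∀ x, HasFDerivAt (fun x => Real.exp (-V₀ x)) (D1 x) x)
    (hG2 : ∀ x, HasFDerivAt D1 (D2 x) x) {b : ℝ} (hb : ∀ φ, b ≤ V₀ φ)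
    {K1 : ℝ} (hK1 : ∀ x, ‖D1 x‖ ≤ K1) {M : ℝ} (hM : ∀ x, ‖D2 x‖ ≤ M) (hUC : UniformContinuous D2)
    {t : ℝ} (ht : 0 < t)
    (hGt1 : ∀ x, HasFDerivAt (G t) (DG x) x) (hGt2 : ∀ x, HasFDerivAt DG (D2G x) x)
    (hGc : ∀ s, Continuous (G s)) {KG : ℝ} (hGb : ∀ s x, |G s x| ≤ KG) {LG : ℝ} (hDG : ∀ x, ‖DG x‖ ≤ LG)
    {MG : ℝ} (hD2G : ∀ x, ‖D2G x‖ ≤ MG) (hUCG : UniformContinuous D2G)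
    (hGdc : Continuous Gd) {Gd0 : ℝ} (hGdb : ∀ y, |Gd y| ≤ Gd0) (hGduc : UniformContinuous Gd)
    (hUG : ∀ ε : ℝ, 0 < ε → ∀ᶠ s in 𝓝 t, ∀ y : EuclideanSpace ℝ (Fin N),
      |G s y - G t y - (s - t) * Gd y| ≤ ε * |s - t|)
    (φ : EuclideanSpace ℝ (Fin N)) :
    HasDerivAt (fun s => ∫ x, Real.exp (-renormPotential D V₀ s (φ + x)) * G s (φ + x)
        ∂(multivariateGaussian 0 (D.Cinf - D.C s)))
      (-((1 / 2) * ∑ i, ∑ j, D.Cdot t i j *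
          ∫ x, ((∫ ζ, Real.exp (-V₀ (φ + x + ζ)) ∂(multivariateGaussian 0 (D.C t))) • D2G (φ + x) +
              (∫ ζ, D1 (φ + x + ζ) ∂(multivariateGaussian 0 (D.C t))).smulRight (DG (φ + x)) +
              (G t (φ + x) • (∫ ζ, D2 (φ + x + ζ) ∂(multivariateGaussian 0 (D.C t))) +
                (DG (φ + x)).smulRight (∫ ζ, D1 (φ + x + ζ) ∂(multivariateGaussian 0 (D.C t)))))
            (EuclideanSpace.single i 1) (EuclideanSpace.single j 1)
            ∂(multivariateGaussian 0 (D.Cinf - D.C t))) +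
        ∫ x, (((1 / 2) * ∑ i, ∑ j, D.Cdot t i j *
            ∫ w, D2 (φ + x + w) (EuclideanSpace.single i 1) (EuclideanSpace.single j 1)
              ∂(multivariateGaussian 0 (D.C t))) * G t (φ + x) +
          (∫ ζ, Real.exp (-V₀ (φ + x + ζ)) ∂(multivariateGaussian 0 (D.C t))) * Gd (φ + x))
          ∂(multivariateGaussian 0 (D.Cinf - D.C t))) t := by
  have hD2c : Continuous D2 := hUC.continuous
  have hc : Continuous fun x => Real.exp (-V₀ x) :=
    continuous_iff_continuousAt.2 fun x => (hG1 x).continuousAt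
  have hV : Measurable V₀ := by
    have he : V₀ = fun x => -Real.log (Real.exp (-V₀ x)) := by
      funext x; rw [Real.log_exp, neg_neg]
    rw [he]
    exact (Real.measurable_log.comp hc.measurable).neg
  have hGbt : ∀ x, |G t x| ≤ KG := hGb t
  have hKG0 : 0 ≤ KG := le_trans (abs_nonneg _) (hGbt 0)
  have hGd00 : 0 ≤ Gd0 := le_trans (abs_nonneg _) (hGdb 0)
  -- `Z_s`, its derivatives at scale `t`, bounds
  have hZ1 : ∀ y, HasFDerivAt
      (fun y => ∫ ζ, Real.exp (-V₀ (y + ζ)) ∂(multivariateGaussian 0 (D.C t)))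
      (∫ ζ, D1 (y + ζ) ∂(multivariateGaussian 0 (D.C t))) y :=
    fun y => hasFDerivAt_integral_exp_neg D hG1 hG2 hb hK1 t y
  have hZ2 : ∀ y, HasFDerivAt (fun y => ∫ ζ, D1 (y + ζ) ∂(multivariateGaussian 0 (D.C t)))
      (∫ ζ, D2 (y + ζ) ∂(multivariateGaussian 0 (D.C t))) y :=
    fun y => hasFDerivAt_integral_fderiv_exp_neg D hG2 hK1 hM hD2c t y
  have hZpos : ∀ (r : ℝ) y, 0 < ∫ ζ, Real.exp (-V₀ (y + ζ)) ∂(multivariateGaussian 0 (D.C r)) :=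
    fun r y => integral_exp_neg_pos hV hb _ y
  have hZle : ∀ (r : ℝ) y, (∫ ζ, Real.exp (-V₀ (y + ζ)) ∂(multivariateGaussian 0 (D.C r))) ≤
      Real.exp (-b) := fun r y => integral_exp_neg_le hV hb _ y
  have hZrb : ∀ (r : ℝ) y, |∫ ζ, Real.exp (-V₀ (y + ζ)) ∂(multivariateGaussian 0 (D.C r))| ≤
      Real.exp (-b) := fun r y => by rw [abs_of_pos (hZpos r y)]; exact hZle r y
  have hZb := hZrb t
  have hDZb : ∀ y, ‖∫ ζ, D1 (y + ζ) ∂(multivariateGaussian 0 (D.C t))‖ ≤ K1 :=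
    fun y => norm_integral_shift_le hK1 _ y
  have hHZb : ∀ y, ‖∫ ζ, D2 (y + ζ) ∂(multivariateGaussian 0 (D.C t))‖ ≤ M :=
    fun y => norm_integral_shift_le hM _ y
  have hZc : ∀ r : ℝ, Continuous fun y => ∫ ζ, Real.exp (-V₀ (y + ζ)) ∂(multivariateGaussian 0 (D.C r)) :=
    fun r => continuous_iff_continuousAt.2 fun y =>
      (hasFDerivAt_integral_exp_neg D hG1 hG2 hb hK1 r y).continuousAt
  have hGtc : Continuous (G t) := hGc t
  -- the product `K_s = Z_s G_s`: derivatives at `t`, bounds, Hessian modulus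
  have hK1' : ∀ y, HasFDerivAt
      (fun y => (∫ ζ, Real.exp (-V₀ (y + ζ)) ∂(multivariateGaussian 0 (D.C t))) * G t y)
      ((∫ ζ, Real.exp (-V₀ (y + ζ)) ∂(multivariateGaussian 0 (D.C t))) • DG y +
        G t y • ∫ ζ, D1 (y + ζ) ∂(multivariateGaussian 0 (D.C t))) y :=
    fun y => (hZ1 y).mul (hGt1 y)
  have hK2' : ∀ y, HasFDerivAt
      (fun y => (∫ ζ, Real.exp (-V₀ (y + ζ)) ∂(multivariateGaussian 0 (D.C t))) • DG y +
        G t y • ∫ ζ, D1 (y + ζ) ∂(multivariateGaussian 0 (D.C t)))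
      ((∫ ζ, Real.exp (-V₀ (y + ζ)) ∂(multivariateGaussian 0 (D.C t))) • D2G y +
          (∫ ζ, D1 (y + ζ) ∂(multivariateGaussian 0 (D.C t))).smulRight (DG y) +
        (G t y • (∫ ζ, D2 (y + ζ) ∂(multivariateGaussian 0 (D.C t))) +
          (DG y).smulRight (∫ ζ, D1 (y + ζ) ∂(multivariateGaussian 0 (D.C t))))) y :=
    fun y => hasFDerivAt_fderiv_mul hZ1 hZ2 hGt1 hGt2 y
  have hKb : ∀ (s : ℝ) y, |(∫ ζ, Real.exp (-V₀ (y + ζ)) ∂(multivariateGaussian 0 (D.C s))) * G s y| ≤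
      Real.exp (-b) * KG := fun s y => by
    rw [abs_mul]
    exact mul_le_mul (hZrb s y) (hGb s y) (abs_nonneg _) (Real.exp_pos _).le
  have hHKb := fun y => norm_fderiv₂_mul_le_of_bounds hZb hGbt hDZb hDG hHZb hD2G y
  have hZuc := uc_of_fderiv_bound hZ1 hDZb
  have hDZuc := uc_of_fderiv_bound hZ2 hHZb
  have hHZuc : UniformContinuous fun y => ∫ ζ, D2 (y + ζ) ∂(multivariateGaussian 0 (D.C t)) :=
    uniformContinuous_integral_shift hD2c hM hUC _
  have hGuc := uc_of_fderiv_bound hGt1 hDG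
  have hDGuc := uc_of_fderiv_bound hGt2 hD2G
  have hHKuc : UniformContinuous fun y =>
      (∫ ζ, Real.exp (-V₀ (y + ζ)) ∂(multivariateGaussian 0 (D.C t))) • D2G y +
          (∫ ζ, D1 (y + ζ) ∂(multivariateGaussian 0 (D.C t))).smulRight (DG y) +
        (G t y • (∫ ζ, D2 (y + ζ) ∂(multivariateGaussian 0 (D.C t))) +
          (DG y).smulRight (∫ ζ, D1 (y + ζ) ∂(multivariateGaussian 0 (D.C t)))) :=
    ((uc_smul hZuc hUCG hZb hD2G).add (uc_smulRight hDZuc hDGuc hDZb hDG)).add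
      ((uc_smul hGuc hHZuc hGbt hHZb).add (uc_smulRight hDGuc hDZuc hDG hDZb))
  -- `Ż_t`: continuity, bound, uniform continuity
  obtain ⟨Mc, hMc⟩ := D.bounded_Cdot
  have hIuc : ∀ i j, UniformContinuous fun y => ∫ w, D2 (y + w) (EuclideanSpace.single i 1)
      (EuclideanSpace.single j 1) ∂(multivariateGaussian 0 (D.C t)) := by
    intro i j
    obtain ⟨hc2, hb2, huc2⟩ := eval₂_facts hM hUC i j
    exact uniformContinuous_integral_shift hc2 (fun x => by
      rw [Real.norm_eq_abs]; exact hb2 x) huc2 (multivariateGaussian 0 (D.C t))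
  have hZduc : UniformContinuous fun y => (1 / 2) * ∑ i, ∑ j, D.Cdot t i j *
      ∫ w, D2 (y + w) (EuclideanSpace.single i 1) (EuclideanSpace.single j 1)
        ∂(multivariateGaussian 0 (D.C t)) :=
    (uc_finset_sum _ (fun i y => ∑ j, D.Cdot t i j *
      ∫ w, D2 (y + w) (EuclideanSpace.single i 1) (EuclideanSpace.single j 1)
        ∂(multivariateGaussian 0 (D.C t))) fun i _ =>
      uc_finset_sum _ (fun j y => D.Cdot t i j *
        ∫ w, D2 (y + w) (EuclideanSpace.single i 1) (EuclideanSpace.single j 1)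
          ∂(multivariateGaussian 0 (D.C t))) fun j _ => (hIuc i j).const_mul' _).const_mul' _
  have hZdc : Continuous fun y => (1 / 2) * ∑ i, ∑ j, D.Cdot t i j *
      ∫ w, D2 (y + w) (EuclideanSpace.single i 1) (EuclideanSpace.single j 1)
        ∂(multivariateGaussian 0 (D.C t)) := hZduc.continuous
  have hZdb : ∀ y, |(1 / 2) * ∑ i, ∑ j, D.Cdot t i j *
      ∫ w, D2 (y + w) (EuclideanSpace.single i 1) (EuclideanSpace.single j 1)
        ∂(multivariateGaussian 0 (D.C t))| ≤ (1 / 2) * ∑ _i : Fin N, ∑ _j : Fin N, Mc * M :=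
    fun y => abs_half_sum_Cdot_integral_le D hM hD2c hMc ht.le y
  have hZdB0 : 0 ≤ (1 / 2) * ∑ _i : Fin N, ∑ _j : Fin N, Mc * M := le_trans (abs_nonneg _) (hZdb 0)
  -- the derivative `K̇ = Ż G_t + Z_t Ġ`: continuity, bound, uniform continuity
  have hGbt' : ∀ x, ‖G t x‖ ≤ KG := fun x => by rw [Real.norm_eq_abs]; exact hGbt x
  have hGdb' : ∀ x, ‖Gd x‖ ≤ Gd0 := fun x => by rw [Real.norm_eq_abs]; exact hGdb x
  have hKdc : Continuous fun y => ((1 / 2) * ∑ i, ∑ j, D.Cdot t i j *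
      ∫ w, D2 (y + w) (EuclideanSpace.single i 1) (EuclideanSpace.single j 1)
        ∂(multivariateGaussian 0 (D.C t))) * G t y +
      (∫ ζ, Real.exp (-V₀ (y + ζ)) ∂(multivariateGaussian 0 (D.C t))) * Gd y :=
    (hZdc.mul hGtc).add ((hZc t).mul hGdc)
  have hKdb : ∀ y, |((1 / 2) * ∑ i, ∑ j, D.Cdot t i j *
      ∫ w, D2 (y + w) (EuclideanSpace.single i 1) (EuclideanSpace.single j 1)
        ∂(multivariateGaussian 0 (D.C t))) * G t y +
      (∫ ζ, Real.exp (-V₀ (y + ζ)) ∂(multivariateGaussian 0 (D.C t))) * Gd y| ≤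
      ((1 / 2) * ∑ _i : Fin N, ∑ _j : Fin N, Mc * M) * KG + Real.exp (-b) * Gd0 := fun y => by
    refine (abs_add_le _ _).trans (add_le_add ?_ ?_)
    · rw [abs_mul]; exact mul_le_mul (hZdb y) (hGbt y) (abs_nonneg _) hZdB0
    · rw [abs_mul]; exact mul_le_mul (hZb y) (hGdb y) (abs_nonneg _) (Real.exp_pos _).le
  have hKduc : UniformContinuous fun y => ((1 / 2) * ∑ i, ∑ j, D.Cdot t i j *
      ∫ w, D2 (y + w) (EuclideanSpace.single i 1) (EuclideanSpace.single j 1)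
        ∂(multivariateGaussian 0 (D.C t))) * G t y +
      (∫ ζ, Real.exp (-V₀ (y + ζ)) ∂(multivariateGaussian 0 (D.C t))) * Gd y :=
    (uc_smul (Y := ℝ) hZduc hGuc hZdb hGbt').add (uc_smul (Y := ℝ) hZuc hGduc hZb hGdb')
  -- the uniform slope of `K_s = Z_s G_s` at `s = t`
  have hU : ∀ ε : ℝ, 0 < ε → ∀ᶠ s in 𝓝 t, ∀ y : EuclideanSpace ℝ (Fin N),
      |(∫ ζ, Real.exp (-V₀ (y + ζ)) ∂(multivariateGaussian 0 (D.C s))) * G s y -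
          (∫ ζ, Real.exp (-V₀ (y + ζ)) ∂(multivariateGaussian 0 (D.C t))) * G t y -
          (s - t) * (((1 / 2) * ∑ i, ∑ j, D.Cdot t i j *
              ∫ w, D2 (y + w) (EuclideanSpace.single i 1) (EuclideanSpace.single j 1)
                ∂(multivariateGaussian 0 (D.C t))) * G t y +
            (∫ ζ, Real.exp (-V₀ (y + ζ)) ∂(multivariateGaussian 0 (D.C t))) * Gd y)| ≤
        ε * |s - t| := by
    intro ε hε
    set ZB : ℝ := (1 / 2) * ∑ _i : Fin N, ∑ _j : Fin N, Mc * M with hZB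
    have ev1 := eventually_abs_integral_exp_neg_sub_sub_mul_le D hG1 hG2 hb hM hUC ht
      (ε := ε / (3 * (KG + 1))) (by positivity)
    have ev2 := hUG (ε / (3 * (Real.exp (-b) + 1))) (by positivity)
    have ev3 := hUG 1 one_pos
    have ev4 : ∀ᶠ s in 𝓝 t, |s - t| < ε / (3 * (ZB * (Gd0 + 1) + 1)) := by
      have h0 : Tendsto (fun s : ℝ => s - t) (𝓝 t) (𝓝 (t - t)) := tendsto_id.sub_const t
      rw [sub_self] at h0
      have h := h0.abs
      rw [abs_zero] at h
      exact (tendsto_order.1 h).2 _ (by positivity)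
    filter_upwards [ev1, ev2, ev3, ev4] with s hs1 hs2 hs3 hs4 y
    set a : ℝ := |s - t| with ha
    have ha0 : 0 ≤ a := abs_nonneg _
    set Zs : ℝ := ∫ ζ, Real.exp (-V₀ (y + ζ)) ∂(multivariateGaussian 0 (D.C s)) with hZs
    set Zt : ℝ := ∫ ζ, Real.exp (-V₀ (y + ζ)) ∂(multivariateGaussian 0 (D.C t)) with hZt
    set Zd : ℝ := (1 / 2) * ∑ i, ∑ j, D.Cdot t i j *
      ∫ w, D2 (y + w) (EuclideanSpace.single i 1) (EuclideanSpace.single j 1)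
        ∂(multivariateGaussian 0 (D.C t)) with hZd
    have h1 : |Zs - Zt - (s - t) * Zd| ≤ ε / (3 * (KG + 1)) * a := hs1 y
    have h2 : |G s y - G t y - (s - t) * Gd y| ≤ ε / (3 * (Real.exp (-b) + 1)) * a := hs2 y
    have h3 : |G s y - G t y| ≤ (Gd0 + 1) * a := by
      have h := hs3 y
      calc |G s y - G t y| = |(G s y - G t y - (s - t) * Gd y) + (s - t) * Gd y| := by ring_nf
        _ ≤ |G s y - G t y - (s - t) * Gd y| + |(s - t) * Gd y| := abs_add_le _ _
        _ ≤ 1 * a + a * Gd0 := by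
            rw [abs_mul]
            exact add_le_add h (mul_le_mul_of_nonneg_left (hGdb y) ha0)
        _ = (Gd0 + 1) * a := by ring
    have hdec : Zs * G s y - Zt * G t y - (s - t) * (Zd * G t y + Zt * Gd y) =
        (Zs - Zt - (s - t) * Zd) * G s y + (s - t) * Zd * (G s y - G t y) +
          Zt * (G s y - G t y - (s - t) * Gd y) := by ring
    rw [hdec]
    have hT1 : |(Zs - Zt - (s - t) * Zd) * G s y| ≤ ε / (3 * (KG + 1)) * a * KG := by
      rw [abs_mul]; exact mul_le_mul h1 (hGb s y) (abs_nonneg _) (by positivity)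
    have hT2 : |(s - t) * Zd * (G s y - G t y)| ≤ a * ZB * ((Gd0 + 1) * a) := by
      rw [abs_mul, abs_mul]
      exact mul_le_mul (mul_le_mul_of_nonneg_left (hZdb y) ha0) h3 (abs_nonneg _) (by positivity)
    have hT3 : |Zt * (G s y - G t y - (s - t) * Gd y)| ≤
        Real.exp (-b) * (ε / (3 * (Real.exp (-b) + 1)) * a) := by
      rw [abs_mul]; exact mul_le_mul (hZb y) h2 (abs_nonneg _) (Real.exp_pos _).le
    have hN1 : ε / (3 * (KG + 1)) * a * KG ≤ ε / 3 * a := by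
      have h : ε / (3 * (KG + 1)) * KG ≤ ε / 3 := by
        rw [div_mul_eq_mul_div, div_le_div_iff₀ (by positivity) (by positivity)]; nlinarith
      nlinarith
    have hN2 : a * ZB * ((Gd0 + 1) * a) ≤ ε / 3 * a := by
      have h : ZB * (Gd0 + 1) * a ≤ ε / 3 := by
        have h5 : (ZB * (Gd0 + 1) + 1) * a < ε / 3 := by
          have := hs4
          rw [lt_div_iff₀ (by positivity)] at this
          linarith
        have : 0 ≤ 1 * a := by positivity
        linarith
      calc a * ZB * ((Gd0 + 1) * a) = (ZB * (Gd0 + 1) * a) * a := by ring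
        _ ≤ ε / 3 * a := mul_le_mul_of_nonneg_right h ha0
    have hN3 : Real.exp (-b) * (ε / (3 * (Real.exp (-b) + 1)) * a) ≤ ε / 3 * a := by
      have h : Real.exp (-b) * (ε / (3 * (Real.exp (-b) + 1))) ≤ ε / 3 := by
        rw [mul_div_assoc', div_le_div_iff₀ (by positivity) (by positivity)]
        nlinarith [Real.exp_pos (-b)]
      calc Real.exp (-b) * (ε / (3 * (Real.exp (-b) + 1)) * a)
          = (Real.exp (-b) * (ε / (3 * (Real.exp (-b) + 1)))) * a := by ring
        _ ≤ ε / 3 * a := mul_le_mul_of_nonneg_right h ha0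
    calc _ ≤ |(Zs - Zt - (s - t) * Zd) * G s y| + |(s - t) * Zd * (G s y - G t y)| +
          |Zt * (G s y - G t y - (s - t) * Gd y)| := abs_add_three _ _ _
      _ ≤ ε / 3 * a + ε / 3 * a + ε / 3 * a := add_le_add (add_le_add (hT1.trans hN1) (hT2.trans hN2))
          (hT3.trans hN3)
      _ = ε * a := by ring
  -- apply the general family rule with `K_s = Z_s G_s`
  have hF := hasDerivAt_integral_family_Cinf_sub D
    (fun s y => (∫ ζ, Real.exp (-V₀ (y + ζ)) ∂(multivariateGaussian 0 (D.C s))) * G s y)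
    (fun y => ((1 / 2) * ∑ i, ∑ j, D.Cdot t i j *
      ∫ w, D2 (y + w) (EuclideanSpace.single i 1) (EuclideanSpace.single j 1)
        ∂(multivariateGaussian 0 (D.C t))) * G t y +
      (∫ ζ, Real.exp (-V₀ (y + ζ)) ∂(multivariateGaussian 0 (D.C t))) * Gd y)
    ht hK1' hK2' (fun s => (hZc s).mul (hGc s)) hKb hHKb hHKuc hKdc hKdb hKduc hU φ
  have hfun : (fun s => ∫ x, Real.exp (-renormPotential D V₀ s (φ + x)) * G s (φ + x)
      ∂(multivariateGaussian 0 (D.Cinf - D.C s))) =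
      fun s => ∫ x, (∫ ζ, Real.exp (-V₀ (φ + x + ζ)) ∂(multivariateGaussian 0 (D.C s))) *
        G s (φ + x) ∂(multivariateGaussian 0 (D.Cinf - D.C s)) := by
    funext s
    simp_rw [exp_neg_renormPotential D hV hb]
  rw [hfun]
  exact hF

/-- **The dual identity with a time-dependent test function** ([BBD] Prop 8 / proof of Thm 3, first
line of (e:dEnt)): under the hypotheses of `hasDerivAt_integral_renormDensity_mul_family`, for `t > 0`,
`d/dt E_{ν_t}[G_t] = −E_{ν_t}[L_tG_t − Ġ]`, with
`L_tG(y) = ½Σ_{ij}Ċ_t^{ij}∂_i∂_jG(y) − Σ_{ij}Ċ_t^{ij}∂_iV_t(y)∂_jG(y)` and `∇V_t = −∇Z_t/Z_t` as certified by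
`hasFDerivAt_renormPotential` («`−d/dt E_{ν_t}[Φ(F_t)] = E_{ν_t}[L_t(Φ(F_t)) − Φ′(F_t)Ḟ_t]`», p0016 L50–55,
in abstract form). [cite: BauerschmidtBodineauDagallier2023, Theorem 3 (proof, (e:dEnt))] -/
theorem hasDerivAt_renormExpect_family
    (hG1 : ∀ x, HasFDerivAt (fun x => Real.exp (-V₀ x)) (D1 x) x)
    (hG2 : ∀ x, HasFDerivAt D1 (D2 x) x) {b : ℝ} (hb : ∀ φ, b ≤ V₀ φ)
    {K1 : ℝ} (hK1 : ∀ x, ‖D1 x‖ ≤ K1) {M : ℝ} (hM : ∀ x, ‖D2 x‖ ≤ M) (hUC : UniformContinuous D2)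
    {t : ℝ} (ht : 0 < t)
    (hGt1 : ∀ x, HasFDerivAt (G t) (DG x) x) (hGt2 : ∀ x, HasFDerivAt DG (D2G x) x)
    (hGc : ∀ s, Continuous (G s)) {KG : ℝ} (hGb : ∀ s x, |G s x| ≤ KG) {LG : ℝ} (hDG : ∀ x, ‖DG x‖ ≤ LG)
    {MG : ℝ} (hD2G : ∀ x, ‖D2G x‖ ≤ MG) (hUCG : UniformContinuous D2G)
    (hGdc : Continuous Gd) {Gd0 : ℝ} (hGdb : ∀ y, |Gd y| ≤ Gd0) (hGduc : UniformContinuous Gd)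
    (hUG : ∀ ε : ℝ, 0 < ε → ∀ᶠ s in 𝓝 t, ∀ y : EuclideanSpace ℝ (Fin N),
      |G s y - G t y - (s - t) * Gd y| ≤ ε * |s - t|) :
    HasDerivAt (fun s => renormExpect D V₀ s (G s))
      (-(renormExpect D V₀ t fun y =>
          (1 / 2) * ∑ i, ∑ j, D.Cdot t i j *
              D2G y (EuclideanSpace.single i 1) (EuclideanSpace.single j 1) -
            ∑ i, ∑ j, D.Cdot t i j *
              (-((∫ ζ, Real.exp (-V₀ (y + ζ)) ∂(multivariateGaussian 0 (D.C t)))⁻¹ •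
                  ∫ ζ, D1 (y + ζ) ∂(multivariateGaussian 0 (D.C t)))) (EuclideanSpace.single i 1) *
                DG y (EuclideanSpace.single j 1) - Gd y)) t := by
  have hD2c : Continuous D2 := hUC.continuous
  have hc : Continuous fun x => Real.exp (-V₀ x) :=
    continuous_iff_continuousAt.2 fun x => (hG1 x).continuousAt
  have hV : Measurable V₀ := by
    have he : V₀ = fun x => -Real.log (Real.exp (-V₀ x)) := by
      funext x; rw [Real.log_exp, neg_neg]
    rw [he]
    exact (Real.measurable_log.comp hc.measurable).neg
  have hGtb : ∀ x, |G t x| ≤ KG := hGb t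
  -- the joint derivative at base point `0`
  have hA := hasDerivAt_integral_renormDensity_mul_family D hG1 hG2 hb hK1 hM hUC ht hGt1 hGt2 hGc hGb
    hDG hD2G hUCG hGdc hGdb hGduc hUG 0
  simp only [zero_add] at hA
  have hB := hA.const_mul (Real.exp (renormPotentialInf D V₀ 0))
  refine hB.congr_deriv ?_
  unfold renormExpect
  rw [← mul_neg]
  -- facts about `Z_t`, `∇Z_t`, `Hess Z_t`, `(G t)`
  have hZ1 : ∀ y, HasFDerivAt
      (fun y => ∫ ζ, Real.exp (-V₀ (y + ζ)) ∂(multivariateGaussian 0 (D.C t)))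
      (∫ ζ, D1 (y + ζ) ∂(multivariateGaussian 0 (D.C t))) y :=
    fun y => hasFDerivAt_integral_exp_neg D hG1 hG2 hb hK1 t y
  have hZ2 : ∀ y, HasFDerivAt (fun y => ∫ ζ, D1 (y + ζ) ∂(multivariateGaussian 0 (D.C t)))
      (∫ ζ, D2 (y + ζ) ∂(multivariateGaussian 0 (D.C t))) y :=
    fun y => hasFDerivAt_integral_fderiv_exp_neg D hG2 hK1 hM hD2c t y
  have hZpos : ∀ y, 0 < ∫ ζ, Real.exp (-V₀ (y + ζ)) ∂(multivariateGaussian 0 (D.C t)) :=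
    fun y => integral_exp_neg_pos hV hb _ y
  have hZc : Continuous fun y => ∫ ζ, Real.exp (-V₀ (y + ζ)) ∂(multivariateGaussian 0 (D.C t)) :=
    continuous_iff_continuousAt.2 fun y => (hZ1 y).continuousAt
  have hDZc : Continuous fun y => ∫ ζ, D1 (y + ζ) ∂(multivariateGaussian 0 (D.C t)) :=
    continuous_iff_continuousAt.2 fun y => (hZ2 y).continuousAt
  have hHZc : Continuous fun y => ∫ ζ, D2 (y + ζ) ∂(multivariateGaussian 0 (D.C t)) :=
    (uniformContinuous_integral_shift hD2c hM hUC _).continuous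
  have hGtc : Continuous (G t) := continuous_iff_continuousAt.2 fun x => (hGt1 x).continuousAt
  have hDGc : Continuous DG := continuous_iff_continuousAt.2 fun x => (hGt2 x).continuousAt
  have hD2Gc : Continuous D2G := hUCG.continuous
  -- evaluation of the integrated Hessian of `e^{−V₀}` on basis vectors
  have hHZij : ∀ (y : EuclideanSpace ℝ (Fin N)) (i j : Fin N),
      (∫ ζ, D2 (y + ζ) ∂(multivariateGaussian 0 (D.C t))) (EuclideanSpace.single i 1)
        (EuclideanSpace.single j 1) =
      ∫ ζ, D2 (y + ζ) (EuclideanSpace.single i 1) (EuclideanSpace.single j 1)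
        ∂(multivariateGaussian 0 (D.C t)) := by
    intro y i j
    have hI : Integrable (fun ζ => D2 (y + ζ)) (multivariateGaussian 0 (D.C t)) :=
      Integrable.of_bound (hD2c.comp (continuous_const.add continuous_id)).aestronglyMeasurable M
        (Eventually.of_forall fun ζ => hM (y + ζ))
    have hI1 : Integrable (fun ζ => D2 (y + ζ) (EuclideanSpace.single i 1))
        (multivariateGaussian 0 (D.C t)) :=
      (ContinuousLinearMap.apply ℝ (EuclideanSpace ℝ (Fin N) →L[ℝ] ℝ)
        (EuclideanSpace.single i (1:ℝ))).integrable_comp hI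
    rw [ContinuousLinearMap.integral_apply hI, ContinuousLinearMap.integral_apply hI1]
  -- continuity of scalar evaluations
  have hev1 : ∀ (u : EuclideanSpace ℝ (Fin N)), Continuous fun L : EuclideanSpace ℝ (Fin N) →L[ℝ] ℝ => L u :=
    fun u => (ContinuousLinearMap.apply ℝ ℝ u).continuous
  have hev2 : ∀ (u w : EuclideanSpace ℝ (Fin N)), Continuous
      fun L : EuclideanSpace ℝ (Fin N) →L[ℝ] EuclideanSpace ℝ (Fin N) →L[ℝ] ℝ => L u w :=
    fun u w => (ContinuousLinearMap.apply ℝ ℝ w).continuous.comp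
      (ContinuousLinearMap.apply ℝ (EuclideanSpace ℝ (Fin N) →L[ℝ] ℝ) u).continuous
  -- integrability over the probability measure `γ_{C_∞ − C_t}` of continuous bounded integrands
  have hInt : ∀ (G : EuclideanSpace ℝ (Fin N) → ℝ), Continuous G → ∀ C : ℝ, (∀ y, |G y| ≤ C) →
      Integrable G (multivariateGaussian 0 (D.Cinf - D.C t)) := fun G hGc C hGC =>
    Integrable.of_bound hGc.aestronglyMeasurable C
      (Eventually.of_forall fun x => by rw [Real.norm_eq_abs]; exact hGC x)
  -- bounds
  obtain ⟨Mc, hMc⟩ := D.bounded_Cdot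
  have hZb : ∀ y, |∫ ζ, Real.exp (-V₀ (y + ζ)) ∂(multivariateGaussian 0 (D.C t))| ≤ Real.exp (-b) :=
    fun y => by rw [abs_of_pos (hZpos y)]; exact integral_exp_neg_le hV hb _ y
  have hDZb : ∀ y, ‖∫ ζ, D1 (y + ζ) ∂(multivariateGaussian 0 (D.C t))‖ ≤ K1 :=
    fun y => norm_integral_shift_le hK1 _ y
  have hHZb : ∀ y, ‖∫ ζ, D2 (y + ζ) ∂(multivariateGaussian 0 (D.C t))‖ ≤ M :=
    fun y => norm_integral_shift_le hM _ y
  have hHKb := fun y => norm_fderiv₂_mul_le_of_bounds hZb hGtb hDZb hDG hHZb hD2G y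
  have hevb : ∀ (L : EuclideanSpace ℝ (Fin N) →L[ℝ] EuclideanSpace ℝ (Fin N) →L[ℝ] ℝ) (i j : Fin N),
      |L (EuclideanSpace.single i 1) (EuclideanSpace.single j 1)| ≤ ‖L‖ := fun L i j => by
    rw [← Real.norm_eq_abs]
    calc ‖L (EuclideanSpace.single i 1) (EuclideanSpace.single j 1)‖
        ≤ ‖L (EuclideanSpace.single i 1)‖ * ‖EuclideanSpace.single j (1:ℝ)‖ :=
          ContinuousLinearMap.le_opNorm _ _
      _ ≤ ‖L‖ * ‖EuclideanSpace.single i (1:ℝ)‖ * ‖EuclideanSpace.single j (1:ℝ)‖ :=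
          mul_le_mul_of_nonneg_right (ContinuousLinearMap.le_opNorm _ _) (norm_nonneg _)
      _ = ‖L‖ := by simp
  have hevb1 : ∀ (L : EuclideanSpace ℝ (Fin N) →L[ℝ] ℝ) (i : Fin N),
      |L (EuclideanSpace.single i 1)| ≤ ‖L‖ := fun L i => by
    rw [← Real.norm_eq_abs]
    calc ‖L (EuclideanSpace.single i 1)‖ ≤ ‖L‖ * ‖EuclideanSpace.single i (1:ℝ)‖ :=
          ContinuousLinearMap.le_opNorm _ _
      _ = ‖L‖ := by simp
  -- the entries of the product Hessian: continuity and integrability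
  have hHKc : ∀ i j, Continuous fun y =>
      ((∫ ζ, Real.exp (-V₀ (y + ζ)) ∂(multivariateGaussian 0 (D.C t))) • D2G y +
          (∫ ζ, D1 (y + ζ) ∂(multivariateGaussian 0 (D.C t))).smulRight (DG y) +
        ((G t) y • (∫ ζ, D2 (y + ζ) ∂(multivariateGaussian 0 (D.C t))) +
          (DG y).smulRight (∫ ζ, D1 (y + ζ) ∂(multivariateGaussian 0 (D.C t)))))
        (EuclideanSpace.single i 1) (EuclideanSpace.single j 1) := by
    intro i j
    exact ((hZc.mul ((hev2 _ _).comp hD2Gc)).add (((hev1 _).comp hDZc).mul ((hev1 _).comp hDGc))).add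
      ((hGtc.mul ((hev2 _ _).comp hHZc)).add (((hev1 _).comp hDGc).mul ((hev1 _).comp hDZc)))
  have hHKint : ∀ i j, Integrable (fun y => D.Cdot t i j *
      ((∫ ζ, Real.exp (-V₀ (y + ζ)) ∂(multivariateGaussian 0 (D.C t))) • D2G y +
          (∫ ζ, D1 (y + ζ) ∂(multivariateGaussian 0 (D.C t))).smulRight (DG y) +
        ((G t) y • (∫ ζ, D2 (y + ζ) ∂(multivariateGaussian 0 (D.C t))) +
          (DG y).smulRight (∫ ζ, D1 (y + ζ) ∂(multivariateGaussian 0 (D.C t)))))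
        (EuclideanSpace.single i 1) (EuclideanSpace.single j 1))
      (multivariateGaussian 0 (D.Cinf - D.C t)) := fun i j =>
    (hInt _ (hHKc i j) _ (fun y => (hevb _ i j).trans (hHKb y))).const_mul _
  -- `Ż_t (G t)` is integrable
  have hIc : ∀ i j, Continuous fun y => ∫ w, D2 (y + w) (EuclideanSpace.single i 1)
      (EuclideanSpace.single j 1) ∂(multivariateGaussian 0 (D.C t)) := by
    intro i j
    have h := (hev2 (EuclideanSpace.single i 1) (EuclideanSpace.single j 1)).comp hHZc
    refine h.congr fun y => ?_
    exact hHZij y i j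
  have hZdc : Continuous fun y => (1 / 2) * ∑ i, ∑ j, D.Cdot t i j *
      ∫ w, D2 (y + w) (EuclideanSpace.single i 1) (EuclideanSpace.single j 1)
        ∂(multivariateGaussian 0 (D.C t)) :=
    continuous_const.mul (continuous_finsetSum _ fun i _ => continuous_finsetSum _ fun j _ =>
      continuous_const.mul (hIc i j))
  have hZdb : ∀ y, |(1 / 2) * ∑ i, ∑ j, D.Cdot t i j *
      ∫ w, D2 (y + w) (EuclideanSpace.single i 1) (EuclideanSpace.single j 1)
        ∂(multivariateGaussian 0 (D.C t))| ≤ (1 / 2) * ∑ _i : Fin N, ∑ _j : Fin N, Mc * M :=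
    fun y => abs_half_sum_Cdot_integral_le D hM hD2c hMc ht.le y
  have hZdFint : Integrable (fun y => ((1 / 2) * ∑ i, ∑ j, D.Cdot t i j *
      ∫ w, D2 (y + w) (EuclideanSpace.single i 1) (EuclideanSpace.single j 1)
        ∂(multivariateGaussian 0 (D.C t))) * (G t) y) (multivariateGaussian 0 (D.Cinf - D.C t)) :=
    hInt _ (hZdc.mul hGtc) (((1 / 2) * ∑ _i : Fin N, ∑ _j : Fin N, Mc * M) * KG) fun y => by
      rw [abs_mul]
      exact mul_le_mul (hZdb y) (hGtb y) (abs_nonneg _) ((abs_nonneg _).trans (hZdb y))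
  -- swap the finite sums and the integral
  have hswap : ∑ i, ∑ j, D.Cdot t i j * ∫ y,
      ((∫ ζ, Real.exp (-V₀ (y + ζ)) ∂(multivariateGaussian 0 (D.C t))) • D2G y +
          (∫ ζ, D1 (y + ζ) ∂(multivariateGaussian 0 (D.C t))).smulRight (DG y) +
        ((G t) y • (∫ ζ, D2 (y + ζ) ∂(multivariateGaussian 0 (D.C t))) +
          (DG y).smulRight (∫ ζ, D1 (y + ζ) ∂(multivariateGaussian 0 (D.C t)))))
        (EuclideanSpace.single i 1) (EuclideanSpace.single j 1) ∂(multivariateGaussian 0 (D.Cinf - D.C t)) =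
      ∫ y, ∑ i, ∑ j, D.Cdot t i j *
        ((∫ ζ, Real.exp (-V₀ (y + ζ)) ∂(multivariateGaussian 0 (D.C t))) • D2G y +
            (∫ ζ, D1 (y + ζ) ∂(multivariateGaussian 0 (D.C t))).smulRight (DG y) +
          ((G t) y • (∫ ζ, D2 (y + ζ) ∂(multivariateGaussian 0 (D.C t))) +
            (DG y).smulRight (∫ ζ, D1 (y + ζ) ∂(multivariateGaussian 0 (D.C t)))))
          (EuclideanSpace.single i 1) (EuclideanSpace.single j 1) ∂(multivariateGaussian 0 (D.Cinf - D.C t)) := by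
    rw [integral_finsetSum _ fun i _ => integrable_finsetSum _ fun j _ => hHKint i j]
    refine Finset.sum_congr rfl fun i _ => ?_
    rw [integral_finsetSum _ fun j _ => hHKint i j]
    refine Finset.sum_congr rfl fun j _ => ?_
    rw [integral_const_mul]
  have hSint : Integrable (fun y => ∑ i, ∑ j, D.Cdot t i j *
      ((∫ ζ, Real.exp (-V₀ (y + ζ)) ∂(multivariateGaussian 0 (D.C t))) • D2G y +
          (∫ ζ, D1 (y + ζ) ∂(multivariateGaussian 0 (D.C t))).smulRight (DG y) +
        ((G t) y • (∫ ζ, D2 (y + ζ) ∂(multivariateGaussian 0 (D.C t))) +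
          (DG y).smulRight (∫ ζ, D1 (y + ζ) ∂(multivariateGaussian 0 (D.C t)))))
        (EuclideanSpace.single i 1) (EuclideanSpace.single j 1)) (multivariateGaussian 0 (D.Cinf - D.C t)) :=
    integrable_finsetSum _ fun i _ => integrable_finsetSum _ fun j _ => hHKint i j
  -- the pointwise identity `Z_t · L_tF = ½ Σ Ċ D²(Z_tF)_{ij} − Ż_t (G t)`
  have hpt : ∀ y : EuclideanSpace ℝ (Fin N),
      (∫ ζ, Real.exp (-V₀ (y + ζ)) ∂(multivariateGaussian 0 (D.C t))) *
        ((1 / 2) * ∑ i, ∑ j, D.Cdot t i j *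
              D2G y (EuclideanSpace.single i 1) (EuclideanSpace.single j 1) -
            ∑ i, ∑ j, D.Cdot t i j *
              (-((∫ ζ, Real.exp (-V₀ (y + ζ)) ∂(multivariateGaussian 0 (D.C t)))⁻¹ •
                  ∫ ζ, D1 (y + ζ) ∂(multivariateGaussian 0 (D.C t)))) (EuclideanSpace.single i 1) *
                DG y (EuclideanSpace.single j 1)) =
      (1 / 2) * (∑ i, ∑ j, D.Cdot t i j *
        ((∫ ζ, Real.exp (-V₀ (y + ζ)) ∂(multivariateGaussian 0 (D.C t))) • D2G y +
            (∫ ζ, D1 (y + ζ) ∂(multivariateGaussian 0 (D.C t))).smulRight (DG y) +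
          ((G t) y • (∫ ζ, D2 (y + ζ) ∂(multivariateGaussian 0 (D.C t))) +
            (DG y).smulRight (∫ ζ, D1 (y + ζ) ∂(multivariateGaussian 0 (D.C t)))))
          (EuclideanSpace.single i 1) (EuclideanSpace.single j 1)) -
        ((1 / 2) * ∑ i, ∑ j, D.Cdot t i j *
          ∫ w, D2 (y + w) (EuclideanSpace.single i 1) (EuclideanSpace.single j 1)
            ∂(multivariateGaussian 0 (D.C t))) * (G t) y := by
    intro y
    set Z : ℝ := ∫ ζ, Real.exp (-V₀ (y + ζ)) ∂(multivariateGaussian 0 (D.C t)) with hZdef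
    set gZ : EuclideanSpace ℝ (Fin N) →L[ℝ] ℝ := ∫ ζ, D1 (y + ζ) ∂(multivariateGaussian 0 (D.C t))
      with hgZdef
    set HZ : EuclideanSpace ℝ (Fin N) →L[ℝ] EuclideanSpace ℝ (Fin N) →L[ℝ] ℝ :=
      ∫ ζ, D2 (y + ζ) ∂(multivariateGaussian 0 (D.C t)) with hHZdef
    have hne : Z ≠ 0 := (hZpos y).ne'
    have hHZ' : ∀ i j, (∫ w, D2 (y + w) (EuclideanSpace.single i 1) (EuclideanSpace.single j 1)
        ∂(multivariateGaussian 0 (D.C t))) = HZ (EuclideanSpace.single i 1) (EuclideanSpace.single j 1) :=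
      fun i j => (hHZij y i j).symm
    have hgV : ∀ i : Fin N, (-(Z⁻¹ • gZ)) (EuclideanSpace.single i 1) =
        -(Z⁻¹ * gZ (EuclideanSpace.single i 1)) := fun i => by
      simp only [_root_.neg_apply, _root_.smul_apply, smul_eq_mul]
    have hHKe : ∀ i j : Fin N, (Z • D2G y + gZ.smulRight (DG y) + ((G t) y • HZ + (DG y).smulRight gZ))
        (EuclideanSpace.single i 1) (EuclideanSpace.single j 1) =
        Z * D2G y (EuclideanSpace.single i 1) (EuclideanSpace.single j 1) +
          gZ (EuclideanSpace.single i 1) * DG y (EuclideanSpace.single j 1) +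
          ((G t) y * HZ (EuclideanSpace.single i 1) (EuclideanSpace.single j 1) +
            DG y (EuclideanSpace.single i 1) * gZ (EuclideanSpace.single j 1)) := fun i j => by
      simp only [_root_.add_apply, _root_.smul_apply, smul_eq_mul, ContinuousLinearMap.smulRight_apply]
    simp_rw [hHZ', hgV, hHKe]
    -- split the sums
    have hS1 : ∑ i, ∑ j, D.Cdot t i j * -(Z⁻¹ * gZ (EuclideanSpace.single i 1)) *
        DG y (EuclideanSpace.single j 1) =
        -Z⁻¹ * ∑ i, ∑ j, D.Cdot t i j *
          (gZ (EuclideanSpace.single i 1) * DG y (EuclideanSpace.single j 1)) := by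
      simp only [Finset.mul_sum]
      refine Finset.sum_congr rfl fun i _ => Finset.sum_congr rfl fun j _ => ?_
      ring
    have hS2 : ∑ i, ∑ j, D.Cdot t i j *
        (Z * D2G y (EuclideanSpace.single i 1) (EuclideanSpace.single j 1) +
          gZ (EuclideanSpace.single i 1) * DG y (EuclideanSpace.single j 1) +
          ((G t) y * HZ (EuclideanSpace.single i 1) (EuclideanSpace.single j 1) +
            DG y (EuclideanSpace.single i 1) * gZ (EuclideanSpace.single j 1))) =
        Z * (∑ i, ∑ j, D.Cdot t i j * D2G y (EuclideanSpace.single i 1) (EuclideanSpace.single j 1)) +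
        (∑ i, ∑ j, D.Cdot t i j *
          (gZ (EuclideanSpace.single i 1) * DG y (EuclideanSpace.single j 1))) +
        (G t) y * (∑ i, ∑ j, D.Cdot t i j * HZ (EuclideanSpace.single i 1) (EuclideanSpace.single j 1)) +
        (∑ i, ∑ j, D.Cdot t i j *
          (DG y (EuclideanSpace.single i 1) * gZ (EuclideanSpace.single j 1))) := by
      simp only [Finset.mul_sum, ← Finset.sum_add_distrib]
      refine Finset.sum_congr rfl fun i _ => Finset.sum_congr rfl fun j _ => ?_
      ring
    have hsymm : ∑ i, ∑ j, D.Cdot t i j *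
        (DG y (EuclideanSpace.single i 1) * gZ (EuclideanSpace.single j 1)) =
        ∑ i, ∑ j, D.Cdot t i j *
          (gZ (EuclideanSpace.single i 1) * DG y (EuclideanSpace.single j 1)) := by
      rw [Finset.sum_comm]
      refine Finset.sum_congr rfl fun j _ => Finset.sum_congr rfl fun i _ => ?_
      rw [D.Cdot_symm ht.le j i]
      ring
    rw [hS1, hS2, hsymm]
    field_simp
    ring
  -- assemble: both sides are integrals of the same function
  rw [hswap]
  have hZGdint : Integrable (fun y => (∫ ζ, Real.exp (-V₀ (y + ζ)) ∂(multivariateGaussian 0 (D.C t))) *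
      Gd y) (multivariateGaussian 0 (D.Cinf - D.C t)) :=
    hInt _ (hZc.mul hGdc) (Real.exp (-b) * Gd0) fun y => by
      rw [abs_mul]
      exact mul_le_mul (hZb y) (hGdb y) (abs_nonneg _) (Real.exp_pos _).le
  have hR : ∫ y, Real.exp (-renormPotential D V₀ t y) *
      ((1 / 2) * ∑ i, ∑ j, D.Cdot t i j *
            D2G y (EuclideanSpace.single i 1) (EuclideanSpace.single j 1) -
          ∑ i, ∑ j, D.Cdot t i j *
            (-((∫ ζ, Real.exp (-V₀ (y + ζ)) ∂(multivariateGaussian 0 (D.C t)))⁻¹ •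
                ∫ ζ, D1 (y + ζ) ∂(multivariateGaussian 0 (D.C t)))) (EuclideanSpace.single i 1) *
              DG y (EuclideanSpace.single j 1) - Gd y) ∂(multivariateGaussian 0 (D.Cinf - D.C t)) =
      ∫ y, (((1 / 2) * (∑ i, ∑ j, D.Cdot t i j *
        ((∫ ζ, Real.exp (-V₀ (y + ζ)) ∂(multivariateGaussian 0 (D.C t))) • D2G y +
            (∫ ζ, D1 (y + ζ) ∂(multivariateGaussian 0 (D.C t))).smulRight (DG y) +
          ((G t) y • (∫ ζ, D2 (y + ζ) ∂(multivariateGaussian 0 (D.C t))) +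
            (DG y).smulRight (∫ ζ, D1 (y + ζ) ∂(multivariateGaussian 0 (D.C t)))))
          (EuclideanSpace.single i 1) (EuclideanSpace.single j 1)) -
        ((1 / 2) * ∑ i, ∑ j, D.Cdot t i j *
          ∫ w, D2 (y + w) (EuclideanSpace.single i 1) (EuclideanSpace.single j 1)
            ∂(multivariateGaussian 0 (D.C t))) * (G t) y) -
        (∫ ζ, Real.exp (-V₀ (y + ζ)) ∂(multivariateGaussian 0 (D.C t))) * Gd y)
          ∂(multivariateGaussian 0 (D.Cinf - D.C t)) := by
    refine integral_congr_ae (Eventually.of_forall fun y => ?_)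
    show Real.exp (-renormPotential D V₀ t y) * _ = _
    rw [exp_neg_renormPotential D hV hb t y, mul_sub, hpt y]
  have h12 : Integrable (fun y => (1 / 2) * (∑ i, ∑ j, D.Cdot t i j *
        ((∫ ζ, Real.exp (-V₀ (y + ζ)) ∂(multivariateGaussian 0 (D.C t))) • D2G y +
            (∫ ζ, D1 (y + ζ) ∂(multivariateGaussian 0 (D.C t))).smulRight (DG y) +
          ((G t) y • (∫ ζ, D2 (y + ζ) ∂(multivariateGaussian 0 (D.C t))) +
            (DG y).smulRight (∫ ζ, D1 (y + ζ) ∂(multivariateGaussian 0 (D.C t)))))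
          (EuclideanSpace.single i 1) (EuclideanSpace.single j 1)) -
        ((1 / 2) * ∑ i, ∑ j, D.Cdot t i j *
          ∫ w, D2 (y + w) (EuclideanSpace.single i 1) (EuclideanSpace.single j 1)
            ∂(multivariateGaussian 0 (D.C t))) * (G t) y) (multivariateGaussian 0 (D.Cinf - D.C t)) :=
    (hSint.const_mul (1 / 2)).sub hZdFint
  rw [hR, integral_sub h12 hZGdint, integral_sub (hSint.const_mul (1 / 2)) hZdFint, integral_const_mul,
    integral_add hZdFint hZGdint]
  ring


end DualFamily

end Polchinski

end Literature.Analysis.FunctionSpaces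

end
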